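import Literature.Geometry.Riemannian.ExpMapGlobalSmooth
import Literature.Geometry.Riemannian.ExpMapDifferential
import Literature.Geometry.Riemannian.JacobiVariation
import Literature.Geometry.Lorentzian.TwoParameterCurvature
import HarnessLib

/-!
# The Jacobi field of the exponential map (Lee 2018, Thm. 10.1, Prop. 10.10) — layer 6a of Thm. 10.34

Towards the last clause of `Literature.Geometry.Riemannian.lee_expMap_injectivityDomain`
(Lee 2018, Thm. 10.34 (c): `d(exp_p)` is invertible on `ID(p)`, i.e. Prop. 10.20 with Thm. 10.26).
For a geodesically complete connection of class `C¹` and `C^∞` on a Hausdorff manifold WITHOUT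
BOUNDARY (no `I.Boundaryless` hypothesis on the model — this is the point of the file; the sibling
`JacobiVariation.lean` of the tree proves the same identities assuming a boundaryless MODEL, through
the geodesic flow of `GeodesicFlow.lean`; here the global smoothness of `exp` of
`ExpMapGlobalSmooth.lean` is used instead), the **geodesic variation**
`X(t, s) = exp_x(t(v + sw)) = γ_{v+sw}(t)`:

* `contMDiff_lift_velocity_uncurry_left` — for a `C^∞` two-parameter map the lift
  `(t, s) ↦ (x(t,s), ∂_t x(t,s)) ∈ TM` is `C^∞` jointly (chart expression: a partial derivative of a
  smooth map, `ContDiffAt.fderiv`);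
* `contMDiff_uncurry_expVariation` — `X` is `C^∞`;
* `jacobi_expVariation` — **the Jacobi equation** `D_t D_t J + R(J, X_t) X_t = 0` for the
  variation field `J = ∂_s X(·, s)` along each `t ↦ X(t, s)` (Lee Thm. 10.1 "variations through
  geodesics give Jacobi fields"; the proof of `JacobiVariation.jacobi_geodesicVariation` verbatim:
  symmetry lemma, curvature identity of `TwoParameterCurvature.lean`, geodesic equation);
* `velocity_expVariation_zero` (`J(0) = 0`) and `velocity_expVariation_eq_mfderiv_expMap`
  (`J(t) = d(exp_x)_{tv}(tw)`, Lee Prop. 10.10).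

No definitions, no named facts (D-0026).

## References

* J. M. Lee, *Introduction to Riemannian Manifolds*, 2nd ed. (2018), Thm. 10.1, Prop. 10.10.
  [LeeRiemannianManifolds2018]
* B. O'Neill, *Semi-Riemannian geometry* (1983), Ch. 4, Prop. 44; Ch. 8, Lemma 3. [ONeill1983]
-/

noncomputable section

open Bundle Set Filter Function
open scoped Manifold ContDiff Topology

namespace Literature.Geometry.Riemannian

open Literature.Geometry.Lorentzian

variable {E : Type*} [NormedAddCommGroup E] [NormedSpace ℝ E] {H : Type*} [TopologicalSpace H]
  {I : ModelWithCorners ℝ E H} {M : Type*} [TopologicalSpace M] [ChartedSpace H M]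
  [IsManifold I ∞ M]

/-! ### The joint lift of a partial velocity -/

/-- **The partial velocity `x_t` of a `C^∞` two-parameter map has a `C^∞` lift, jointly in
`(t, s)`**: `(t, s) ↦ (x(t, s), x_t(t, s)) ∈ TM` is `C^∞` (in the trivialisation at `x(t₀, s₀)` the
fibre coordinate is, near `(t₀, s₀)`, the `t`-derivative of the `C^∞` chart expression, a `C^∞`
function of `(t, s)` by `ContDiffAt.fderiv`). O'Neill 1983, Ch. 4, p. 122.
[cite: ONeill1983, Ch. 4, p. 122] -/
theorem contMDiff_lift_velocity_uncurry_left {x : ℝ → ℝ → M}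
    (hx : ContMDiff (𝓘(ℝ, ℝ).prod 𝓘(ℝ, ℝ)) I ∞ (uncurry x)) :
    ContMDiff (𝓘(ℝ, ℝ).prod 𝓘(ℝ, ℝ)) I.tangent ∞
      (fun q : ℝ × ℝ ↦ (TotalSpace.mk' E (x q.1 q.2) (velocity I (fun t ↦ x t q.2) q.1) :
        TangentBundle I M)) := by
  rintro ⟨t₀, s₀⟩
  set e := trivializationAt E (TangentSpace I : M → Type _) (x t₀ s₀) with he_def
  have hsrc : ∀ᶠ q : ℝ × ℝ in 𝓝 (t₀, s₀), x q.1 q.2 ∈ (chartAt H (x t₀ s₀)).source :=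
    hx.continuous.continuousAt.preimage_mem_nhds
      ((chartAt H (x t₀ s₀)).open_source.mem_nhds (mem_chart_source H (x t₀ s₀)))
  have hmem : (TotalSpace.mk' E (x t₀ s₀) (velocity I (fun t ↦ x t s₀) t₀) : TangentBundle I M) ∈
      e.source :=
    e.mem_source.2 (FiberBundle.mem_baseSet_trivializationAt' (x t₀ s₀))
  rw [e.contMDiffAt_iff
    (f := fun q : ℝ × ℝ ↦ (TotalSpace.mk' E (x q.1 q.2) (velocity I (fun t ↦ x t q.2) q.1) :
      TangentBundle I M)) hmem]
  refine ⟨hx (t₀, s₀), ?_⟩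
  -- the chart expression `F (q, t') = φ (x t' q.2)` is smooth jointly
  have hX : ContDiffAt ℝ ∞ (fun q : ℝ × ℝ ↦ extChartAt I (x t₀ s₀) (x q.1 q.2)) (t₀, s₀) :=
    contDiffAt_extChartAt_uncurry (hx (t₀, s₀))
  have hF : ContDiffAt ℝ ∞ (uncurry fun (q : ℝ × ℝ) (t' : ℝ) ↦ extChartAt I (x t₀ s₀) (x t' q.2))
      ((t₀, s₀), t₀) := by
    have hlin : ContDiff ℝ ∞ (fun z : (ℝ × ℝ) × ℝ ↦ ((z.2, z.1.2) : ℝ × ℝ)) :=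
      (contDiff_snd.prodMk (contDiff_snd.comp contDiff_fst))
    have h := hX.comp ((t₀, s₀), t₀) hlin.contDiffAt
    exact h
  have hD : ContDiffAt ℝ ∞
      (fun q : ℝ × ℝ ↦ fderiv ℝ (fun t' ↦ extChartAt I (x t₀ s₀) (x t' q.2)) q.1 (1 : ℝ)) (t₀, s₀) := by
    have h1 : ContDiffAt ℝ ∞
        (fun q : ℝ × ℝ ↦ fderiv ℝ (fun t' ↦ extChartAt I (x t₀ s₀) (x t' q.2)) q.1) (t₀, s₀) :=
      ContDiffAt.fderiv (f := fun (q : ℝ × ℝ) (t' : ℝ) ↦ extChartAt I (x t₀ s₀) (x t' q.2))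
        (g := fun q : ℝ × ℝ ↦ q.1) hF contDiffAt_fst (by simp)
    exact h1.clm_apply contDiffAt_const
  have heq : (fun q : ℝ × ℝ ↦ (e ⟨x q.1 q.2, velocity I (fun t ↦ x t q.2) q.1⟩).2) =ᶠ[𝓝 (t₀, s₀)]
      fun q : ℝ × ℝ ↦ fderiv ℝ (fun t' ↦ extChartAt I (x t₀ s₀) (x t' q.2)) q.1 (1 : ℝ) := by
    filter_upwards [hsrc] with q hq
    rw [he_def, trivializationAt_velocity_curry_left
      (mdifferentiableAt_curry_left (hx (q.1, q.2)) (by simp)) hq]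
    rfl
  have hD' : ContMDiffAt (𝓘(ℝ, ℝ).prod 𝓘(ℝ, ℝ)) 𝓘(ℝ, E) ∞
      (fun q : ℝ × ℝ ↦ fderiv ℝ (fun t' ↦ extChartAt I (x t₀ s₀) (x t' q.2)) q.1 (1 : ℝ)) (t₀, s₀) := by
    have h := contMDiffAt_iff_contDiffAt.2 hD
    rw [modelWithCornersSelf_prod, ← chartedSpaceSelf_prod] at h
    exact h
  exact hD'.congr_of_eventuallyEq heq

/-! ### The geodesic variation of the exponential map -/

section Variation

variable [FiniteDimensional ℝ E] [CompleteSpace E] [T2Space M] [BoundarylessManifold I M]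
  {cov : CovariantDerivative I E (TangentSpace I : M → Type _)}
  [CovariantDerivative.ContMDiffCovariantDerivative cov 1]
  [CovariantDerivative.ContMDiffCovariantDerivative cov ∞]

/-- **The geodesic variation `X(t, s) = exp_x(t(v + sw))` is `C^∞`** on a geodesically complete
`C^∞` connection (no boundarylessness of the model is needed): `(t, s) ↦ (x, t(v + sw)) ∈ TM` is
smooth and `exp` is `C^∞` on `TM = 𝓔` (`contMDiffOn_expMap_totalSpace`). Lee 2018, Prop. 5.19 and
Prop. 10.10 (proof). [cite: LeeRiemannianManifolds2018, Prop. 5.19] -/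
theorem contMDiff_uncurry_expVariation (hc : IsGeodesicallyComplete cov) (x : M)
    (v w : TangentSpace I x) :
    ContMDiff (𝓘(ℝ, ℝ).prod 𝓘(ℝ, ℝ)) I ∞
      (uncurry fun t s : ℝ ↦ expMap cov x (t • (v + s • w))) := by
  have hA : ContMDiff (𝓘(ℝ, ℝ).prod 𝓘(ℝ, ℝ)) 𝓘(ℝ, E) ∞
      (fun q : ℝ × ℝ ↦ q.1 • ((show E from v) + q.2 • (show E from w))) :=
    contMDiff_fst.smul (contMDiff_const.add (contMDiff_snd.smul contMDiff_const))
  have hι := contMDiff_tangentTotalSpaceMk (I := I) (M := M) x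
  have hB : ContMDiff (𝓘(ℝ, ℝ).prod 𝓘(ℝ, ℝ)) I.tangent ∞
      (fun q : ℝ × ℝ ↦ (⟨x, q.1 • ((show E from v) + q.2 • (show E from w))⟩ : TangentBundle I M)) :=
    hι.comp hA
  have hexp := contMDiffOn_expMap_totalSpace (cov := cov) (k := (⊤ : ℕ∞)) le_top
  have hdom : ∀ q : ℝ × ℝ,
      (⟨x, q.1 • ((show E from v) + q.2 • (show E from w))⟩ : TangentBundle I M) ∈
        {p : TangentBundle I M | (1 : ℝ) ∈ maximalGeodesicDomain cov p.proj p.2} := fun q ↦ by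
    show (1 : ℝ) ∈ maximalGeodesicDomain cov x _
    rw [(maximalGeodesic_of_isGeodesicallyComplete hc x _).1]
    exact mem_univ _
  have h := hexp.comp_contMDiff hB hdom
  exact h

omit [CovariantDerivative.ContMDiffCovariantDerivative cov ∞] in
/-- The `t`-curves of the variation are the geodesics `γ_{v+sw}` (`expMap_smul`).
[cite: LeeRiemannianManifolds2018, Prop. 5.19 (b)] -/
theorem expVariation_eq_maximalGeodesic (hc : IsGeodesicallyComplete cov) (x : M)
    (v w : TangentSpace I x) (t s : ℝ) :
    expMap cov x (t • (v + s • w)) = maximalGeodesic cov x (v + s • w) t :=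
  expMap_smul hc x (v + s • w) t

omit [CovariantDerivative.ContMDiffCovariantDerivative cov ∞] in
/-- The `t`-curves of the variation are geodesics on `ℝ`. [cite: LeeRiemannianManifolds2018, Prop. 5.19 (b)] -/
theorem isGeodesic_expVariation (hc : IsGeodesicallyComplete cov) (x : M) (v w : TangentSpace I x)
    (s : ℝ) : IsGeodesic cov (fun t : ℝ ↦ expMap cov x (t • (v + s • w))) := by
  have hfun : (fun t : ℝ ↦ expMap cov x (t • (v + s • w))) = maximalGeodesic cov x (v + s • w) :=
    funext fun t ↦ expVariation_eq_maximalGeodesic hc x v w t s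
  rw [hfun]
  exact (maximalGeodesic_of_isGeodesicallyComplete hc x (v + s • w)).2.1

/-- **Variations through geodesics give Jacobi fields** (Lee 2018, Thm. 10.1; O'Neill 1983, Ch. 8,
Lemma 3): for the variation `X(t, s) = exp_x(t(v + sw))` of a complete, torsion-free, `C^∞`
connection, the variation field `J = ∂_s X(·, s)` along `t ↦ X(t, s)` satisfies
`D_t D_t J + R(J, X_t) X_t = 0` at every `t₀` — the proof of
`JacobiVariation.jacobi_geodesicVariation` (symmetry lemma, curvature identity
`D_t D_s Z − D_s D_t Z = R(x_t, x_s) Z` for `Z = X_t`, geodesic equation `D_t X_t = 0`).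
[cite: LeeRiemannianManifolds2018, Thm. 10.1] -/
theorem jacobi_expVariation (hcov₁ : cov.IsLocallyContMDiff 1) (htors : cov.torsion = 0)
    (hc : IsGeodesicallyComplete cov) (x : M) (v w : TangentSpace I x) (s t₀ : ℝ) :
    covariantDerivAlong cov (fun t ↦ expMap cov x (t • (v + s • w)))
        (fun t ↦ covariantDerivAlong cov (fun t ↦ expMap cov x (t • (v + s • w)))
          (fun t ↦ velocity I (fun s' : ℝ ↦ expMap cov x (t • (v + s' • w))) s) t) t₀ +
      cov.curvature (expMap cov x (t₀ • (v + s • w)))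
        (velocity I (fun s' : ℝ ↦ expMap cov x (t₀ • (v + s' • w))) s)
        (velocity I (fun t ↦ expMap cov x (t • (v + s • w))) t₀)
        (velocity I (fun t ↦ expMap cov x (t • (v + s • w))) t₀) = 0 := by
  set X : ℝ → ℝ → M := fun t s ↦ expMap cov x (t • (v + s • w)) with hX_def
  have hXs : ContMDiff (𝓘(ℝ, ℝ).prod 𝓘(ℝ, ℝ)) I ∞ (uncurry X) :=
    contMDiff_uncurry_expVariation hc x v w
  have h2 : (2 : ℕ∞ω) ≤ ∞ := WithTop.coe_le_coe.2 le_top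
  have hX2 : ∀ q : ℝ × ℝ, ContMDiffAt (𝓘(ℝ, ℝ).prod 𝓘(ℝ, ℝ)) I 2 (uncurry X) q :=
    fun q ↦ (hXs q).of_le h2
  -- the `t`-curves are geodesics
  have hgeo : ∀ s' t, covariantDerivAlong cov (fun t ↦ X t s')
      (fun t ↦ velocity I (fun t ↦ X t s') t) t = 0 :=
    fun s' t ↦ (isGeodesic_expVariation hc x v w s').2 t (mem_univ t)
  -- symmetry lemma at every parameter
  have hsymm : ∀ t s', covariantDerivAlong cov (fun t' ↦ X t' s') (fun t' ↦ velocity I (X t') s') t =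
      covariantDerivAlong cov (X t) (fun s'' ↦ velocity I (fun t' ↦ X t' s'') t) s' :=
    fun t s' ↦ covariantDerivAlong_velocity_comm cov htors (hX2 (t, s'))
  -- the lift of `∂_t X` is smooth
  have hT : ∀ q : ℝ × ℝ, ContMDiffAt (𝓘(ℝ, ℝ).prod 𝓘(ℝ, ℝ)) I.tangent 2
      (fun q : ℝ × ℝ ↦ (TotalSpace.mk' E (X q.1 q.2) (velocity I (fun t' ↦ X t' q.2) q.1) :
        TangentBundle I M)) q :=
    fun q ↦ ((contMDiff_lift_velocity_uncurry_left hXs) q).of_le h2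
  -- curvature identity for `Z = ∂_t X` at `(t₀, s)`
  have hcurv := covariantDerivAlong_covariantDerivAlong_sub_eq_curvature (cov := cov) hcov₁
    (x := X) (Z := fun t s' ↦ velocity I (fun t' ↦ X t' s') t) (t := t₀) (s := s) (hX2 (t₀, s))
    (hT (t₀, s))
  beta_reduce at hcurv
  -- the term `D_s (D_t ∂_t X)` vanishes
  have hzero : (fun s' ↦ covariantDerivAlong cov (fun t' ↦ X t' s')
      (fun t' ↦ velocity I (fun t' ↦ X t' s') t') t₀) = fun s' ↦ (0 : TangentSpace I (X t₀ s')) :=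
    funext fun s' ↦ hgeo s' t₀
  rw [hzero, covariantDerivAlong_zero_field, sub_zero] at hcurv
  -- replace `D_s ∂_t X` by `D_t ∂_s X` inside the outer derivative
  have hinner : (fun t' ↦ covariantDerivAlong cov (X t')
      (fun s'' ↦ velocity I (fun t'' ↦ X t'' s'') t') s) =
      fun t' ↦ covariantDerivAlong cov (fun t'' ↦ X t'' s) (fun t'' ↦ velocity I (X t'') s) t' :=
    funext fun t' ↦ (hsymm t' s).symm
  rw [hinner, CovariantDerivative.curvature_antisymm] at hcurv
  have key : covariantDerivAlong cov (fun t ↦ X t s)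
        (fun t ↦ covariantDerivAlong cov (fun t ↦ X t s) (fun t ↦ velocity I (X t) s) t) t₀ +
      cov.curvature (X t₀ s) (velocity I (X t₀) s) (velocity I (fun t ↦ X t s) t₀)
        (velocity I (fun t ↦ X t s) t₀) = 0 := by
    rw [hcurv, neg_add_cancel]
  exact key

omit [CovariantDerivative.ContMDiffCovariantDerivative cov ∞] in
/-- **`J(0) = 0`**: all the curves `s ↦ X(0, s) = exp_x 0 = x` are constant.
[cite: LeeRiemannianManifolds2018, Prop. 10.10] -/
theorem velocity_expVariation_zero (x : M) (v w : TangentSpace I x) (s : ℝ) :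
    velocity I (fun s' : ℝ ↦ expMap cov x ((0 : ℝ) • (v + s' • w))) s = 0 := by
  have h : (fun s' : ℝ ↦ expMap cov x ((0 : ℝ) • (v + s' • w))) = fun _ : ℝ ↦ x := by
    funext s'
    rw [zero_smul]
    exact expMap_zero (cov := cov) x
  rw [h]
  exact velocity_const x s

/-- **The variation field is the differential of the exponential map** (Lee 2018, Prop. 10.10:
`J(t) = d(exp_p)_{tv}(tw)`): `∂_s|_{s=0} exp_x(t(v + sw)) = d(exp_x)_{tv}(tw)`.
[cite: LeeRiemannianManifolds2018, Prop. 10.10] -/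
theorem velocity_expVariation_eq_mfderiv_expMap (hc : IsGeodesicallyComplete cov) (x : M)
    (v w : TangentSpace I x) (t : ℝ) :
    velocity I (fun s : ℝ ↦ expMap cov x (t • (v + s • w))) 0 =
      mfderiv 𝓘(ℝ, E) I (fun u : E ↦ expMap cov x (show TangentSpace I x from u))
        (t • (show E from v)) (t • (show E from w)) := by
  have h : (fun s : ℝ ↦ expMap cov x (t • (v + s • w))) = fun s : ℝ ↦
      (fun u : E ↦ expMap cov x (show TangentSpace I x from u))
        (t • (show E from v) + s • (t • (show E from w))) := by
    funext s
    have h1 : t • (show E from v) + s • (t • (show E from w)) = t • (v + s • w) := by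
      simp only [smul_add, smul_comm s t]
      rfl
    rw [h1]
  rw [h]
  exact velocity_comp_lineAt_zero
    ((contMDiff_expMap_of_isGeodesicallyComplete (cov := cov) (k := (⊤ : ℕ∞)) le_top hc x _).mdifferentiableAt
      (by simp)) _

end Variation

end Literature.Geometry.Riemannian
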